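import Literature.IUT.HodgeTheaters.ThetaPMEllHodgeTheaters

/-!
# [IUTchI] §6, Definition 6.11 / Corollary 6.12: the `ℱ`-level isomorphisms of Θ^±-bridges, Θ^{ell}-bridges, Θ^{±ell}-Hodge theaters

Mochizuki, *Inter-universal Teichmüller theory I*, §6: Definition 6.11 (i)–(iii) pp. 172–173 (the
ISOMORPHISM clauses), Corollary 6.12 (i), (ii) p. 173, Remark 6.12.1 p. 174, kurims manuscript (May
2020) ([IUTchI] Def 6.11-Cor 6.12 pp.172-174) [claim: Mochizuki2012, status: disputed]. Sibling of
`ThetaPMEllHodgeTheaters.lean` (abc-iut-L5-t4), whose `ThetaPMBridge.Iso` / `ThetaEllBridge.Iso` /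
`ThetaPMEllHT.Iso` are the isomorphisms of the ASSOCIATED `𝒟`-objects. Here the printed `ℱ`-level notion
is typed faithfully (L5-lead ruling 2026-08-25 F3): "a pair of poly-isomorphisms `†𝔉_T ⥲ ‡𝔉_{T'}`;
`†𝔉_≻ ⥲ ‡𝔉_≻` that lifts a morphism between the associated `𝒟-Θ^±`-bridges" = the `𝒟`-level isomorphism
`toD` TOGETHER WITH `ℱ`-level poly-isomorphisms (sets of isomorphisms of `ℱ`-prime-strips) whose images
under `𝔉 ↦ 𝔇` (Rmk 5.2.1 (i), `FStrip.assocDMap`) are the poly-isomorphisms of `toD`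
(`ThetaPMBridge.IsoF`, `ThetaEllBridge.IsoF`, `ThetaPMEllHT.IsoF`). Then:

* Cor 6.12 (i) "the natural functorially induced map … is bijective" is the GENUINE statement
  `Function.Bijective IsoF.toD` (`IsoFToDBijective` ×3, `Cor612iF`) — and it is PROVED here from
  Cor 5.3 (ii) `FKit.IsomFtoDBijective` ("follow[s] immediately from Definition 6.11; Corollary 5.3,
  (ii)"): injectivity of `𝔉 ↦ 𝔇` on isomorphisms makes the lifting poly-isomorphisms unique,
  surjectivity (Rmk 5.3.1 `liftPoly`) makes them exist;
* Cor 6.12 (ii) with `ℱ`-LEVEL gluing data (`GluingDataF`, `GluingTorsorF`), PROVED from Cor 5.3 (ii)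
  and Prop 6.6 (iv) `GluingTorsor` ("[cf. also Proposition 6.6, (iv)]");
* Rmk 6.12.1 at the `ℱ`-level (`FunctorialDynamicsPMF`: the analogue of Prop 6.8 (i)).

Nothing of IUT is asserted: the theorems are implications from the named statements Cor 5.3 (ii) /
Prop 6.6 (iv).
-/

namespace Literature.IUT.HodgeTheaters

open CategoryTheory

universe u

namespace PMBaseKit

variable {l : ℕ} {K : PMBaseKit.{u} l} {M : K.MultKit} (FK : K.FKit M)

namespace FKit

namespace ThetaPMBridge

variable {FK}

/-- An **isomorphism of Θ^±-bridges** `(†𝔉_T → †𝔉_≻) ⥲ (‡𝔉_{T'} → ‡𝔉_≻)`: "a pair of poly-isomorphisms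
`†𝔉_T ⥲ ‡𝔉_{T'}`; `†𝔉_≻ ⥲ ‡𝔉_≻` that lifts a morphism between the associated `𝒟-Θ^±`-bridges `†φ^{Θ±}_±`,
`‡φ^{Θ±}_±`" ([IUTchI] Def 6.11 (i) p. 172). Typed faithfully: the isomorphism `toD` of the associated
`𝒟-Θ^±`-bridges (Def 6.4 (i): index bijection an isomorphism of `𝔽_l^±`-groups, capsule-`+`-full /
`+`-full poly-isomorphisms compatible with the bridges) TOGETHER WITH the `ℱ`-level poly-isomorphisms
— sets of isomorphisms of `ℱ`-prime-strips, constituent-wise on the capsules over the index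
bijection of `toD` — whose images under `𝔉 ↦ 𝔇` (Rmk 5.2.1 (i), `FStrip.assocDMap`) ARE the
poly-isomorphisms of `toD` ("lifts"). That such a pair is determined by `toD` is Cor 6.12 (i), a
statement (`IsoToDBijective`), not a definition. ([IUTchI] Def 6.11 (i) p.172) [claim: Mochizuki2012, status: disputed] -/
structure IsoF (B₁ B₂ : FK.ThetaPMBridge) where
  /-- the isomorphism of the associated `𝒟-Θ^±`-bridges that the pair lifts -/
  toD : Iso B₁ B₂
  /-- the poly-isomorphism `†𝔉_T ⥲ ‡𝔉_{T'}`: its constituents `†𝔉_t ⥲ ‡𝔉_{ι t}` over the index bijection `ι` of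
  `toD` -/
  capsPoly : ∀ t : B₁.T, Set ((B₁.capsule t).Iso (B₂.capsule (toD.indexEquiv t)))
  /-- the poly-isomorphism `†𝔉_≻ ⥲ ‡𝔉_≻` -/
  codPoly : Set (B₁.codomain.Iso B₂.codomain)
  /-- "lifts": the associated poly-isomorphism of `𝒟`-prime-strips of `capsPoly t` is the constituent of
  `toD` at `t` -/
  capsPoly_lifts : ∀ t, FStrip.assocDMap '' capsPoly t = toD.capsPoly t
  /-- "lifts": the associated poly-isomorphism of `𝒟`-prime-strips of `codPoly` is that of `toD` -/
  codPoly_lifts : FStrip.assocDMap '' codPoly = toD.codPoly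

/-- **Cor 6.12 (i), Θ^±-bridges**: "The natural functorially induced map from the set of isomorphisms
between two Θ^±-bridges … to the set of isomorphisms between the respective associated
`𝒟-Θ^±`-bridges … is bijective" ([IUTchI] Cor 6.12 (i) p. 173; "follow[s] immediately from Definition
6.11; Corollary 5.3, (ii)") — named statement, NOT asserted; the natural map is `IsoF.toD`.
([IUTchI] Cor 6.12 (i) p.173) [claim: Mochizuki2012, status: disputed] -/
def IsoFToDBijective (B₁ B₂ : FK.ThetaPMBridge) : Prop :=
  Function.Bijective (IsoF.toD : IsoF B₁ B₂ → Iso B₁ B₂)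

end ThetaPMBridge

namespace ThetaEllBridge

variable {FK}

/-- An **isomorphism of Θ^{ell}-bridges**: "a pair of poly-isomorphisms `†𝔉_T ⥲ ‡𝔉_{T'}`; `†𝒟^{⊚±} ⥲ ‡𝒟^{⊚±}`
that determines a morphism between the associated `𝒟-Θ^{ell}`-bridges `†φ^{Θell}_±`, `‡φ^{Θell}_±`" ([IUTchI]
Def 6.11 (ii) p. 173). Typed faithfully: the isomorphism `toD` of the associated `𝒟-Θ^{ell}`-bridges
(Def 6.4 (ii); its `Aut_csp`-orbit `globPoly` IS the second component `†𝒟^{⊚±} ⥲ ‡𝒟^{⊚±}`, a `𝒟`-level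
object having no `ℱ`-lift) together with the `ℱ`-level capsule poly-isomorphism lifting the capsule
component of `toD`. ([IUTchI] Def 6.11 (ii) p.173) [claim: Mochizuki2012, status: disputed] -/
structure IsoF (B₁ B₂ : FK.ThetaEllBridge) where
  /-- the isomorphism of the associated `𝒟-Θ^{ell}`-bridges that the pair determines -/
  toD : Iso B₁ B₂
  /-- the poly-isomorphism `†𝔉_T ⥲ ‡𝔉_{T'}`, constituent-wise over the index bijection of `toD` -/
  capsPoly : ∀ t : B₁.T, Set ((B₁.capsule t).Iso (B₂.capsule (toD.indexEquiv t)))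
  /-- "determines": the associated poly-isomorphism of `𝒟`-prime-strips of `capsPoly t` is the
  constituent of `toD` at `t` -/
  capsPoly_lifts : ∀ t, FStrip.assocDMap '' capsPoly t = toD.capsPoly t

/-- **Cor 6.12 (i), Θ^{ell}-bridges**: "The natural functorially induced map from the set of
isomorphisms between … two Θ^{ell}-bridges … to the set of isomorphisms between the respective …
associated `𝒟-Θ^{ell}`-bridges … is bijective" ([IUTchI] Cor 6.12 (i) p. 173) — named statement, NOT
asserted; the natural map is `IsoF.toD`. ([IUTchI] Cor 6.12 (i) p.173) [claim: Mochizuki2012, status: disputed] -/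
def IsoFToDBijective (B₁ B₂ : FK.ThetaEllBridge) : Prop :=
  Function.Bijective (IsoF.toD : IsoF B₁ B₂ → Iso B₁ B₂)

end ThetaEllBridge

namespace ThetaPMEllHT

variable {FK}

/-- An **isomorphism of Θ^{±ell}-Hodge theaters**: "a pair of morphisms between the respective
associated Θ^±- and Θ^{ell}-bridges that are compatible with one another in the sense that they induce
the same poly-isomorphism between the respective capsules of `ℱ`-prime-strips" ([IUTchI] Def 6.11
(iii) p. 173). Typed as: the isomorphism `toD` of the associated `𝒟-Θ^{±ell}`-Hodge theaters (Def 6.4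
(iii): a compatible pair of `𝒟`-bridge isomorphisms) together with THE common `ℱ`-level capsule
poly-isomorphism `†𝔉_T ⥲ ‡𝔉_{T'}` and the `ℱ`-level poly-isomorphism `†𝔉_≻ ⥲ ‡𝔉_≻`, lifting the
corresponding components of `toD`; the two members of the printed pair are `IsoF.pmIsoF` and the
Θ^{ell}-bridge isomorphism with the same capsule component (so "compatible" holds by construction).
([IUTchI] Def 6.11 (iii) p.173) [claim: Mochizuki2012, status: disputed] -/
structure IsoF (H₁ H₂ : FK.ThetaPMEllHT) where
  /-- the isomorphism of the associated `𝒟-Θ^{±ell}`-Hodge theaters -/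
  toD : Iso H₁ H₂
  /-- the common poly-isomorphism of capsules of `ℱ`-prime-strips `†𝔉_T ⥲ ‡𝔉_{T'}`, constituent-wise
  over the index bijection of `toD` -/
  capsPoly : ∀ t : H₁.T, Set ((H₁.capsule t).Iso (H₂.capsule (toD.pmIso.indexEquiv t)))
  /-- the poly-isomorphism `†𝔉_≻ ⥲ ‡𝔉_≻` of the Θ^±-bridge component -/
  codPoly : Set (H₁.codomain.Iso H₂.codomain)
  /-- lifts the capsule component of `toD` -/
  capsPoly_lifts : ∀ t, FStrip.assocDMap '' capsPoly t = toD.pmIso.capsPoly t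
  /-- lifts the `†𝔇_≻ ⥲ ‡𝔇_≻` component of `toD` -/
  codPoly_lifts : FStrip.assocDMap '' codPoly = toD.pmIso.codPoly

/-- The Θ^±-bridge component of an isomorphism of Θ^{±ell}-Hodge theaters ([IUTchI] Def 6.11 (iii)
p. 173 "a pair of morphisms between the respective associated Θ^±- and Θ^{ell}-bridges").
([IUTchI] Def 6.11 (iii) p.173) [claim: Mochizuki2012, status: disputed] -/
def IsoF.pmIsoF {H₁ H₂ : FK.ThetaPMEllHT} (f : IsoF H₁ H₂) : ThetaPMBridge.IsoF H₁.pmBridge H₂.pmBridge where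
  toD := f.toD.pmIso
  capsPoly := f.capsPoly
  codPoly := f.codPoly
  capsPoly_lifts := f.capsPoly_lifts
  codPoly_lifts := f.codPoly_lifts

/-- **Cor 6.12 (i), Θ^{±ell}-Hodge theaters**: "The natural functorially induced map from the set of
isomorphisms between … two Θ^{±ell}-Hodge theaters … to the set of isomorphisms between the respective
… associated `𝒟-Θ^{±ell}`-Hodge theaters … is bijective" ([IUTchI] Cor 6.12 (i) p. 173) — named
statement, NOT asserted; the natural map is `IsoF.toD`. ([IUTchI] Cor 6.12 (i) p.173) [claim: Mochizuki2012, status: disputed] -/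
def IsoFToDBijective (H₁ H₂ : FK.ThetaPMEllHT) : Prop :=
  Function.Bijective (IsoF.toD : IsoF H₁ H₂ → Iso H₁ H₂)

end ThetaPMEllHT

/-! ### Corollary 6.12 -/

/-- **Cor 6.12 (i)** (all three cases): "The natural functorially induced map from the set of
isomorphisms between two Θ^±-bridges (respectively, two Θ^{ell}-bridges; two Θ^{±ell}-Hodge theaters) to
the set of isomorphisms between the respective associated `𝒟-Θ^±`-bridges (respectively, associated
`𝒟-Θ^{ell}`-bridges; associated `𝒟-Θ^{±ell}`-Hodge theaters) is bijective" ([IUTchI] Cor 6.12 (i) p. 173;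
proof: Def 6.11 + Cor 5.3 (ii)) — named statement over the kit, NOT asserted.
([IUTchI] Cor 6.12 (i) p.173) [claim: Mochizuki2012, status: disputed] -/
def Cor612iF : Prop :=
  (∀ B₁ B₂ : FK.ThetaPMBridge, ThetaPMBridge.IsoFToDBijective B₁ B₂) ∧
    (∀ B₁ B₂ : FK.ThetaEllBridge, ThetaEllBridge.IsoFToDBijective B₁ B₂) ∧
      ∀ H₁ H₂ : FK.ThetaPMEllHT, ThetaPMEllHT.IsoFToDBijective H₁ H₂

/-- An `ℱ`-level gluing datum: "capsule-`+`-full poly-isomorphisms between the respective capsules of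
`ℱ`-prime-strips" of a Θ^±-bridge and a Θ^{ell}-bridge ([IUTchI] Cor 6.12 (ii) p. 173) — a bijection of
index sets and constituent poly-isomorphisms of `ℱ`-prime-strips whose associated poly-isomorphisms of
`𝒟`-prime-strips are `+`-full ("positive" for `ℱ`-prime-strips meaning "the induced automorphism of the
associated `𝒟`-prime-strip is positive", Def 6.11 (i) p. 172). ([IUTchI] Cor 6.12 (ii) p.173) [claim: Mochizuki2012, status: disputed] -/
structure GluingDataF (B : FK.ThetaPMBridge) (B' : FK.ThetaEllBridge) where
  /-- the bijection of index sets -/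
  indexEquiv : B.T ≃ B'.T
  /-- the constituent poly-isomorphisms `†𝔉_t ⥲ ‡𝔉_{ι t}` -/
  poly : ∀ t, Set ((B.capsule t).Iso (B'.capsule (indexEquiv t)))
  /-- each lifts a `+`-full poly-isomorphism of `𝒟`-prime-strips -/
  poly_plusFull : ∀ t, DStrip.IsPlusFullPolyIso (FStrip.assocDMap '' poly t)

/-- The `𝒟`-level gluing datum (Prop 6.6 (iv), `GluingData`) associated to an `ℱ`-level one.
([IUTchI] Cor 6.12 (ii) p.173) [claim: Mochizuki2012, status: disputed] -/
def GluingDataF.toD {B : FK.ThetaPMBridge} {B' : FK.ThetaEllBridge} (G : GluingDataF FK B B') :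
    GluingData B.dBridge B'.dBridge where
  indexEquiv := G.indexEquiv
  poly t := FStrip.assocDMap '' G.poly t
  poly_plusFull := G.poly_plusFull

/-- An `ℱ`-level gluing datum "allow[s] one to glue the given Θ^±- and Θ^{ell}-bridges together to form a
Θ^{±ell}-Hodge theater" ([IUTchI] Cor 6.12 (ii) p. 173): the condition on a Θ^{±ell}-Hodge theater being
that its associated `𝒟`-data form a `𝒟-Θ^{±ell}`-Hodge theater (Def 6.11 (iii)), this is `Glues` for the
associated `𝒟`-level datum (Prop 6.6 (iv)). ([IUTchI] Cor 6.12 (ii) p.173) [claim: Mochizuki2012, status: disputed] -/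
def GluingDataF.Glues {B : FK.ThetaPMBridge} {B' : FK.ThetaEllBridge} (G : GluingDataF FK B B') : Prop :=
  G.toD.Glues

/-- **Cor 6.12 (ii)**: "Given a Θ^±-bridge and a Θ^{ell}-bridge, the set of capsule-`+`-full
poly-isomorphisms between the respective capsules of `ℱ`-prime-strips which allow one to glue the given
Θ^±- and Θ^{ell}-bridges together to form a Θ^{±ell}-Hodge theater forms a torsor over the group
`𝔽_l^{⋊±} × ({±1}^𝕍)` [cf. Proposition 6.6, (iv)]. Moreover, the first factor may be thought of as
corresponding to the induced isomorphisms of `𝔽_l^±`-torsors between the index sets of the capsules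
involved" ([IUTchI] Cor 6.12 (ii) p. 173; proof: Cor 5.3 (ii) + Prop 6.6 (iv)). Rendered as for
Prop 6.6 (iv) (`GluingTorsor`) but with `ℱ`-LEVEL gluing data: such data exist; their index bijections
are exactly the torsor-isomorphisms `T ⥲ T'` (an `𝔽_l^{⋊±}`-torsor); over each such bijection the gluing
data correspond bijectively to `{±1}^𝕍` — named statement, NOT asserted (guard `Nonempty 𝕍` as in
Prop 6.6). ([IUTchI] Cor 6.12 (ii) p.173) [claim: Mochizuki2012, status: disputed] -/
def GluingTorsorF (B : FK.ThetaPMBridge) (B' : FK.ThetaEllBridge) : Prop :=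
  Nonempty K.V → (∃ G : GluingDataF FK B B', G.Glues) ∧
    (∀ ι : B.T ≃ B'.T, B.grpT.toTorsor.Compat B'.torT ι →
      ∃ G : GluingDataF FK B B', G.Glues ∧ G.indexEquiv = ι) ∧
    ∀ ι : B.T ≃ B'.T, B.grpT.toTorsor.Compat B'.torT ι →
      Nonempty ({G : GluingDataF FK B B' // G.Glues ∧ G.indexEquiv = ι} ≃ (K.V → ℤˣ))

/-! ### Remark 6.12.1 -/

/-- **Rmk 6.12.1**: "By applying Corollary 6.12, a similar remark to Remark 5.6.1 [functorial
dynamics: analogues of Propositions 4.8, (i), (ii); 4.9; 4.11] may be made concerning the Θ^±-bridges,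
Θ^{ell}-bridges, and Θ^{±ell}-Hodge theaters studied in the present §6. We leave the routine details to
the reader" ([IUTchI] Rmk 6.12.1 p. 174) — recorded as the `ℱ`-level analogue of the `𝔽_l^{⋊±}`-symmetry
of Prop 6.8 (i) (`DThetaPMEllHT.EllBridgeSymmetry`; the `𝒟`-level reading is `FunctorialDynamicsPM` of the sibling file): the isomorphisms of the Θ^{ell}-bridge underlying a
Θ^{±ell}-Hodge theater act transitively on `T` through their index bijections and number `2·|T|` (via
Cor 6.12 (i) this is Prop 6.8 (i)); named statement, NOT asserted.
([IUTchI] Rmk 6.12.1 p.174) [claim: Mochizuki2012, status: disputed] -/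
def FunctorialDynamicsPMF : Prop :=
  ∀ H : FK.ThetaPMEllHT, Nonempty K.V →
    (∀ t₁ t₂ : H.T, ∃ g : ThetaEllBridge.IsoF H.ellBridge H.ellBridge, g.toD.indexEquiv t₁ = t₂) ∧
      Nat.card (ThetaEllBridge.IsoF H.ellBridge H.ellBridge) = 2 * Nat.card H.T


/-! ### Proofs from Corollary 5.3 (ii) and Proposition 6.6 (iv) -/

section Proofs

variable {FK}

/-- Under Cor 5.3 (ii), two poly-isomorphisms of `ℱ`-prime-strips with the same associated
poly-isomorphism of `𝒟`-prime-strips coincide ([IUTchI] Rmk 5.3.1 (i) p. 146 "uniquely determines").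
([IUTchI] Rmk 5.3.1 (i) p.146) [claim: Mochizuki2012, status: disputed] -/
theorem poly_eq_of_image_assocDMap_eq (h : FK.IsomFtoDBijective) {F₁ F₂ : FK.FStrip}
    {P Q : Set (F₁.Iso F₂)} (hPQ : FStrip.assocDMap '' P = FStrip.assocDMap '' Q) : P = Q :=
  (h F₁ F₂).1.image_injective hPQ

/-- Under Cor 5.3 (ii), the lift `liftPoly Φ` of a poly-isomorphism of `𝒟`-prime-strips has associated
poly-isomorphism `Φ` ([IUTchI] Rmk 5.3.1 (ii) p. 146). ([IUTchI] Rmk 5.3.1 (ii) p.146) [claim: Mochizuki2012, status: disputed] -/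
theorem image_assocDMap_liftPoly (h : FK.IsomFtoDBijective) {F₁ F₂ : FK.FStrip}
    (Φ : Set (F₁.assocD.Iso F₂.assocD)) : FStrip.assocDMap '' liftPoly Φ = Φ :=
  (liftPoly_bijOn h Φ).image_eq

namespace ThetaPMBridge

/-- **Cor 6.12 (i), Θ^±-bridges, PROVED from Cor 5.3 (ii)**: the natural map `Iso B₁ B₂ → Iso(𝒟-Θ^±)` is
bijective ([IUTchI] Cor 6.12 (i) p. 173). ([IUTchI] Cor 6.12 (i) p.173) [claim: Mochizuki2012, status: disputed] -/
theorem isoFToDBijective_of_isomFtoDBijective (h : FK.IsomFtoDBijective) (B₁ B₂ : FK.ThetaPMBridge) :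
    IsoFToDBijective B₁ B₂ := by
  constructor
  · rintro ⟨d, cp, cd, hcp, hcd⟩ ⟨d', cp', cd', hcp', hcd'⟩ hdd
    change d = d' at hdd
    subst hdd
    obtain rfl : cp = cp' :=
      funext fun t => poly_eq_of_image_assocDMap_eq h ((hcp t).trans (hcp' t).symm)
    obtain rfl : cd = cd' := poly_eq_of_image_assocDMap_eq h (hcd.trans hcd'.symm)
    rfl
  · intro d
    exact ⟨⟨d, fun t => liftPoly (d.capsPoly t), liftPoly d.codPoly,
      fun t => image_assocDMap_liftPoly h _, image_assocDMap_liftPoly h _⟩, rfl⟩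

end ThetaPMBridge

namespace ThetaEllBridge

/-- **Cor 6.12 (i), Θ^{ell}-bridges, PROVED from Cor 5.3 (ii)** ([IUTchI] Cor 6.12 (i) p. 173).
([IUTchI] Cor 6.12 (i) p.173) [claim: Mochizuki2012, status: disputed] -/
theorem isoFToDBijective_of_isomFtoDBijective (h : FK.IsomFtoDBijective) (B₁ B₂ : FK.ThetaEllBridge) :
    IsoFToDBijective B₁ B₂ := by
  constructor
  · rintro ⟨d, cp, hcp⟩ ⟨d', cp', hcp'⟩ hdd
    change d = d' at hdd
    subst hdd
    obtain rfl : cp = cp' :=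
      funext fun t => poly_eq_of_image_assocDMap_eq h ((hcp t).trans (hcp' t).symm)
    rfl
  · intro d
    exact ⟨⟨d, fun t => liftPoly (d.capsPoly t), fun t => image_assocDMap_liftPoly h _⟩, rfl⟩

end ThetaEllBridge

namespace ThetaPMEllHT

/-- **Cor 6.12 (i), Θ^{±ell}-Hodge theaters, PROVED from Cor 5.3 (ii)** ([IUTchI] Cor 6.12 (i) p. 173).
([IUTchI] Cor 6.12 (i) p.173) [claim: Mochizuki2012, status: disputed] -/
theorem isoFToDBijective_of_isomFtoDBijective (h : FK.IsomFtoDBijective) (H₁ H₂ : FK.ThetaPMEllHT) :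
    IsoFToDBijective H₁ H₂ := by
  constructor
  · rintro ⟨d, cp, cd, hcp, hcd⟩ ⟨d', cp', cd', hcp', hcd'⟩ hdd
    change d = d' at hdd
    subst hdd
    obtain rfl : cp = cp' :=
      funext fun t => poly_eq_of_image_assocDMap_eq h ((hcp t).trans (hcp' t).symm)
    obtain rfl : cd = cd' := poly_eq_of_image_assocDMap_eq h (hcd.trans hcd'.symm)
    rfl
  · intro d
    exact ⟨⟨d, fun t => liftPoly (d.pmIso.capsPoly t), liftPoly d.pmIso.codPoly,
      fun t => image_assocDMap_liftPoly h _, image_assocDMap_liftPoly h _⟩, rfl⟩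

end ThetaPMEllHT

/-- **Cor 6.12 (i), all three cases, PROVED from Cor 5.3 (ii)** ([IUTchI] Cor 6.12 (i) p. 173: "follow[s]
immediately from Definition 6.11; Corollary 5.3, (ii)"). ([IUTchI] Cor 6.12 (i) p.173) [claim: Mochizuki2012, status: disputed] -/
theorem cor612iF_of_isomFtoDBijective (h : FK.IsomFtoDBijective) : FK.Cor612iF :=
  ⟨ThetaPMBridge.isoFToDBijective_of_isomFtoDBijective h,
    ThetaEllBridge.isoFToDBijective_of_isomFtoDBijective h,
    ThetaPMEllHT.isoFToDBijective_of_isomFtoDBijective h⟩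


/-- The `ℱ`-level gluing datum lifting a `𝒟`-level one (Rmk 5.3.1 `liftPoly`), under Cor 5.3 (ii).
([IUTchI] Cor 6.12 (ii) p.173) [claim: Mochizuki2012, status: disputed] -/
noncomputable def GluingDataF.lift (h : FK.IsomFtoDBijective) {B : FK.ThetaPMBridge} {B' : FK.ThetaEllBridge}
    (Gd : GluingData B.dBridge B'.dBridge) : GluingDataF FK B B' where
  indexEquiv := Gd.indexEquiv
  poly t := liftPoly (Gd.poly t)
  poly_plusFull t := by
    rw [image_assocDMap_liftPoly h]
    exact Gd.poly_plusFull t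

/-- The lift projects back. ([IUTchI] Cor 6.12 (ii) p.173) [claim: Mochizuki2012, status: disputed] -/
theorem GluingDataF.toD_lift (h : FK.IsomFtoDBijective) {B : FK.ThetaPMBridge} {B' : FK.ThetaEllBridge}
    (Gd : GluingData B.dBridge B'.dBridge) : (GluingDataF.lift h Gd).toD = Gd := by
  obtain ⟨ι, p, hp⟩ := Gd
  simp only [GluingDataF.toD, GluingDataF.lift]
  congr 1
  funext t
  exact image_assocDMap_liftPoly h _

/-- `toD` is injective under Cor 5.3 (ii). ([IUTchI] Cor 6.12 (ii) p.173) [claim: Mochizuki2012, status: disputed] -/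
theorem GluingDataF.toD_injective (h : FK.IsomFtoDBijective) {B : FK.ThetaPMBridge} {B' : FK.ThetaEllBridge} :
    Function.Injective (GluingDataF.toD (FK := FK) (B := B) (B' := B')) := by
  rintro ⟨ι, p, hp⟩ ⟨ι', p', hp'⟩ hG
  simp only [GluingDataF.toD, GluingData.mk.injEq] at hG
  obtain ⟨hι, hpoly⟩ := hG
  subst hι
  have hpp := eq_of_heq hpoly
  obtain rfl : p = p' := funext fun t => poly_eq_of_image_assocDMap_eq h (congrFun hpp t)
  rfl

/-- **Cor 6.12 (ii), PROVED from Cor 5.3 (ii) and Prop 6.6 (iv)** ("[cf. also Proposition 6.6, (iv), in the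
case of assertion (ii)]", [IUTchI] Cor 6.12 p. 173): the `ℱ`-level gluing torsor statement follows from
the `𝒟`-level one for the associated base bridges. ([IUTchI] Cor 6.12 (ii) p.173) [claim: Mochizuki2012, status: disputed] -/
theorem gluingTorsorF_of_isomFtoDBijective (h : FK.IsomFtoDBijective) (B : FK.ThetaPMBridge)
    (B' : FK.ThetaEllBridge) (hT : GluingTorsor B.dBridge B'.dBridge) : GluingTorsorF FK B B' := by
  intro hV
  obtain ⟨⟨Gd, hGd⟩, h2, h3⟩ := hT hV
  refine ⟨⟨GluingDataF.lift h Gd, ?_⟩, fun ι hι => ?_, fun ι hι => ?_⟩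
  · show (GluingDataF.lift h Gd).toD.Glues
    rw [GluingDataF.toD_lift h]; exact hGd
  · obtain ⟨Gd, hGd, rfl⟩ := h2 ι hι
    exact ⟨GluingDataF.lift h Gd, by show (GluingDataF.lift h Gd).toD.Glues; rw [GluingDataF.toD_lift h]; exact hGd,
      rfl⟩
  · obtain ⟨e⟩ := h3 ι hι
    refine ⟨Equiv.trans (Equiv.ofBijective
      (fun G : {G : GluingDataF FK B B' // G.Glues ∧ G.indexEquiv = ι} =>
        (⟨G.1.toD, G.2.1, G.2.2⟩ : {G : GluingData B.dBridge B'.dBridge // G.Glues ∧ G.indexEquiv = ι}))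
      ⟨?_, ?_⟩) e⟩
    · rintro ⟨G₁, hG₁⟩ ⟨G₂, hG₂⟩ hh
      exact Subtype.ext (GluingDataF.toD_injective h (congrArg Subtype.val hh))
    · rintro ⟨Gd, hGd, hι'⟩
      refine ⟨⟨GluingDataF.lift h Gd, ?_, hι'⟩, ?_⟩
      · show (GluingDataF.lift h Gd).toD.Glues
        rw [GluingDataF.toD_lift h]; exact hGd
      · exact Subtype.ext (GluingDataF.toD_lift h Gd)

end Proofs

end FKit

end PMBaseKit

end Literature.IUT.HodgeTheaters
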